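import Literature.NumberTheory.EllipticCurves.Curve6137TwoIsogenyDescent
import Literature.NumberTheory.EllipticCurves.IwasawaLeadingTermProofs
import HarnessLib

/-!
# `E₀ : y² = x(x + 50)(x − 40) = x³ + 10x² − 2000x` has rank `0` and `Ш(E₀/ℚ)[2] = 0` by a SHARP descent via `2`-isogeny
# (the anchor of an isogeny class in which Cassels–Tate parity is NEEDED two steps away)

Topic `NumberTheory/EllipticCurves`. First file of the cell `Curve2000*` (seat bsd-line-spt-p1 g13): the full-`2`-torsion curve
`E₀ = [0, 10, 0, −2000, 0]`, `E₀' = E₀.twoIsogenyCodomain = [0, −20, 0, 8100, 0]`. Descent on the divisors of `b = −2000` and of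
`b' = 8100` (Silverman, AEC X.4.9): `S(10, −2000) = {1, −2, −5, 10}` (the images of the three rational `2`-torsion points; the
other four classes die modulo `3`), `S(−20, 8100) = {1}` (negative classes over `ℝ`, the rest modulo `16`, `25`, `64`, `125`);
hence `dim₂ S + dim₂ S' = 2 = rank + 2` with **`rank E₀(ℚ) = 0`**, the descent is sharp, **`Ш(E₀/ℚ)[2] = 0`**, **`t_2(E₀) = 0`**.
The sequel files move two `2`-isogeny steps away from `E₀`, where a `2`-torsion class of `Ш` hides from the isogeny descent.
Everything is re-verified by the kernel. Theorems only; no definitions, no named facts.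

## References

* [SilvermanAEC2009] J. H. Silverman, *AEC*, 2nd ed.: Prop. X.4.9, Example X.4.10, Prop. X.4.7 with Thm. X.4.2(a).
* [SilvermanTate2015] J. H. Silverman, J. Tate, *Rational Points on Elliptic Curves*, §3.5–§3.6.
-/

noncomputable section

open scoped Classical

namespace Literature.NumberTheory.EllipticCurves

namespace Curve2000

open _root_.WeierstrassCurve _root_.WeierstrassCurve.Affine

/-! ## 0. The curves -/

/-- `b(a² − 4b) ≠ 0` for `E₀ = E_{10,-2000}`. [cite: SilvermanAEC2009, Prop. X.4.9] -/
theorem habY : (-2000 : ℤ) * ((10 : ℤ) ^ 2 - 4 * (-2000)) ≠ 0 := by norm_num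

/-- The tree's literal `E_{10,-2000}` is `E₀`. [cite: SilvermanAEC2009, Prop. X.4.9] -/
theorem lit_Y : (⟨0, ((10 : ℤ) : ℚ), 0, ((-2000 : ℤ) : ℚ), 0⟩ : WeierstrassCurve ℚ) = ⟨0, 10, 0, -2000, 0⟩ := by
  ext <;> push_cast <;> ring

/-- The tree's literal `E_{−2a, a²−4b}` for `(a,b) = (10,-2000)` is `E₀' = [0, -20, 0, 8100, 0]`. [cite: SilvermanAEC2009, Prop. X.4.9] -/
theorem lit_Y' :
    (⟨0, ((-2 * (10) : ℤ) : ℚ), 0, (((10 : ℤ) ^ 2 - 4 * (-2000) : ℤ) : ℚ), 0⟩ : WeierstrassCurve ℚ) = ⟨0, -20, 0, 8100, 0⟩ := by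
  ext <;> push_cast <;> ring

/-- The half-model literal for `(a,b) = (10,-2000)`. [cite: SilvermanAEC2009, Prop. X.4.9] -/
private theorem lit_V₀Y :
    (⟨0, -((10 : ℤ) : ℚ) / 2, 0, (((10 : ℤ) : ℚ) ^ 2 - 4 * (-2000 : ℤ)) / 16, 0⟩ : WeierstrassCurve ℚ) =
      ⟨0, (-5), 0, (2025 / 4), 0⟩ := by
  ext <;> push_cast <;> ring

/-- `E₀ = [0, 10, 0, -2000, 0]` is an elliptic curve. [cite: SilvermanAEC2009, Prop. X.4.9] -/
theorem isElliptic_Y : (⟨0, 10, 0, -2000, 0⟩ : WeierstrassCurve ℚ).IsElliptic := by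
  rw [← lit_Y]; exact isElliptic_mk_of_ne_zero (F := ℚ) habY

/-- `E₀' = [0, -20, 0, 8100, 0]` is an elliptic curve. [cite: SilvermanAEC2009, Prop. X.4.9] -/
theorem isElliptic_Y' : (⟨0, -20, 0, 8100, 0⟩ : WeierstrassCurve ℚ).IsElliptic := by
  rw [← lit_Y']; exact isElliptic_mk_of_ne_zero (F := ℚ) (twoIsogenyCodomain_ne_zero habY)

/-- The half-model of `E₀'` is an elliptic curve. [cite: SilvermanAEC2009, Prop. X.4.9] -/
private theorem isElliptic_V₀Y : (⟨0, (-5), 0, (2025 / 4), 0⟩ : WeierstrassCurve ℚ).IsElliptic := by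
  rw [← lit_V₀Y]; exact isElliptic_halfModel habY

/-! ## 1. The sharp descent on `E₀`: rank `0`, `Ш(E₀/ℚ)[2] = 0`, `t_2(E₀) = 0` -/

/-- `S(10, -2000)` does not contain: `d = -1, 2, 5, -10` modulo `3` (no solution of either chart modulo the stated prime power; the sharp model).
[cite: SilvermanAEC2009, Example X.4.10 (the congruence method)] -/
theorem not_mem_S_Y :
    (-1 : ℤ) ∉ twoIsogenySelmerGroup (10) (-2000) ∧
      (2 : ℤ) ∉ twoIsogenySelmerGroup (10) (-2000) ∧
      (5 : ℤ) ∉ twoIsogenySelmerGroup (10) (-2000) ∧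
      (-10 : ℤ) ∉ twoIsogenySelmerGroup (10) (-2000) := by
  have hB : (-2000 : ℤ) ≠ 0 := by norm_num
  haveI : Fact (Nat.Prime 3) := ⟨by norm_num⟩
  refine ⟨?_, ?_, ?_, ?_⟩
  · refine Carrier6137.not_mem_twoIsogenySelmerGroup_of_not_isSoluble hB 3 ?_
    rw [show (-2000 : ℤ) / -1 = 2000 by norm_num]
    exact Carrier6137.not_isSoluble_padic_twoIsogenyQuartic_of_zmodPow 1 (by decide)
  · refine Carrier6137.not_mem_twoIsogenySelmerGroup_of_not_isSoluble hB 3 ?_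
    rw [show (-2000 : ℤ) / 2 = -1000 by norm_num]
    exact Carrier6137.not_isSoluble_padic_twoIsogenyQuartic_of_zmodPow 1 (by decide)
  · refine Carrier6137.not_mem_twoIsogenySelmerGroup_of_not_isSoluble hB 3 ?_
    rw [show (-2000 : ℤ) / 5 = -400 by norm_num]
    exact Carrier6137.not_isSoluble_padic_twoIsogenyQuartic_of_zmodPow 1 (by decide)
  · refine Carrier6137.not_mem_twoIsogenySelmerGroup_of_not_isSoluble hB 3 ?_
    rw [show (-2000 : ℤ) / -10 = 200 by norm_num]
    exact Carrier6137.not_isSoluble_padic_twoIsogenyQuartic_of_zmodPow 1 (by decide)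

/-- A squarefree integer dividing `-2000` is `±` a divisor of `10`. [cite: SilvermanAEC2009, Prop. X.4.9] -/
private theorem mem_of_dvd_bY {d : ℤ} (hsq : Squarefree d) (hd : d ∣ (-2000 : ℤ)) :
    d ∈ ({1, -1, 2, -2, 5, -5, 10, -10} : Finset ℤ) := by
  have hrad : d ∣ 10 := by
    have h5 : d ∣ (10 : ℤ) ^ 4 := dvd_trans hd ⟨-5, by norm_num⟩
    exact (hsq.dvd_pow_iff_dvd (by norm_num)).mp h5
  have h1 : d.natAbs ∣ 10 := by
    have := Int.natAbs_dvd_natAbs.mpr hrad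
    simpa using this
  have h2 : d.natAbs ∈ Nat.divisors 10 := Nat.mem_divisors.mpr ⟨h1, by norm_num⟩
  rw [show Nat.divisors 10 = {1, 2, 5, 10} by decide +kernel] at h2
  simp only [Finset.mem_insert, Finset.mem_singleton] at h2 ⊢
  rcases Int.natAbs_eq d with h | h <;> rw [h] <;>
    rcases h2 with h2 | h2 | h2 | h2 <;> simp [h2]

/-- **`S(10, -2000) ⊆ {1, -2, -5, 10}`**. [cite: SilvermanAEC2009, Prop. X.4.9 and Example X.4.10] -/
theorem twoIsogenySelmerGroup_Y_subset :
    twoIsogenySelmerGroup (10) (-2000) ⊆ ({1, -2, -5, 10} : Finset ℤ) := by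
  intro d hd
  obtain ⟨hsq, hdvd, -⟩ := (mem_twoIsogenySelmerGroup_iff (a := 10) (by norm_num : (-2000 : ℤ) ≠ 0)).mp hd
  have hmem := mem_of_dvd_bY hsq hdvd
  obtain ⟨hm1, h2, h5, hm10⟩ := not_mem_S_Y
  simp only [Finset.mem_insert, Finset.mem_singleton] at hmem ⊢
  rcases hmem with rfl | rfl | rfl | rfl | rfl | rfl | rfl | rfl
  · simp
  · exact absurd hd hm1
  · exact absurd hd h2
  · simp
  · exact absurd hd h5
  · simp
  · simp
  · exact absurd hd hm10

/-- `S(-20, 8100)` does not contain: `d = -1, -2, 3, 6, -5, -10, 15, 30` modulo `16`; `d = 5, -30` modulo `25`; `d = -3` modulo `32`; `d = -6, 10` modulo `64`; `d = 2, -15` modulo `125` (no solution of either chart modulo the stated prime power; the sharp model, other side).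
[cite: SilvermanAEC2009, Example X.4.10 (the congruence method)] -/
theorem not_mem_S'_Y :
    (-1 : ℤ) ∉ twoIsogenySelmerGroup (-20) (8100) ∧
      (2 : ℤ) ∉ twoIsogenySelmerGroup (-20) (8100) ∧
      (-2 : ℤ) ∉ twoIsogenySelmerGroup (-20) (8100) ∧
      (3 : ℤ) ∉ twoIsogenySelmerGroup (-20) (8100) ∧
      (-3 : ℤ) ∉ twoIsogenySelmerGroup (-20) (8100) ∧
      (6 : ℤ) ∉ twoIsogenySelmerGroup (-20) (8100) ∧
      (-6 : ℤ) ∉ twoIsogenySelmerGroup (-20) (8100) ∧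
      (5 : ℤ) ∉ twoIsogenySelmerGroup (-20) (8100) ∧
      (-5 : ℤ) ∉ twoIsogenySelmerGroup (-20) (8100) ∧
      (10 : ℤ) ∉ twoIsogenySelmerGroup (-20) (8100) ∧
      (-10 : ℤ) ∉ twoIsogenySelmerGroup (-20) (8100) ∧
      (15 : ℤ) ∉ twoIsogenySelmerGroup (-20) (8100) ∧
      (-15 : ℤ) ∉ twoIsogenySelmerGroup (-20) (8100) ∧
      (30 : ℤ) ∉ twoIsogenySelmerGroup (-20) (8100) ∧
      (-30 : ℤ) ∉ twoIsogenySelmerGroup (-20) (8100) := by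
  have hB : (8100 : ℤ) ≠ 0 := by norm_num
  haveI : Fact (Nat.Prime 2) := ⟨by norm_num⟩
  haveI : Fact (Nat.Prime 5) := ⟨by norm_num⟩
  refine ⟨?_, ?_, ?_, ?_, ?_, ?_, ?_, ?_, ?_, ?_, ?_, ?_, ?_, ?_, ?_⟩
  · refine Carrier6137.not_mem_twoIsogenySelmerGroup_of_not_isSoluble hB 2 ?_
    rw [show (8100 : ℤ) / -1 = -8100 by norm_num]
    exact Carrier6137.not_isSoluble_padic_twoIsogenyQuartic_of_zmodPow 4 (by decide)
  · refine Carrier6137.not_mem_twoIsogenySelmerGroup_of_not_isSoluble hB 5 ?_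
    rw [show (8100 : ℤ) / 2 = 4050 by norm_num]
    exact Carrier6137.not_isSoluble_padic_twoIsogenyQuartic_of_zmodPow 3 (by decide +kernel)
  · refine Carrier6137.not_mem_twoIsogenySelmerGroup_of_not_isSoluble hB 2 ?_
    rw [show (8100 : ℤ) / -2 = -4050 by norm_num]
    exact Carrier6137.not_isSoluble_padic_twoIsogenyQuartic_of_zmodPow 4 (by decide)
  · refine Carrier6137.not_mem_twoIsogenySelmerGroup_of_not_isSoluble hB 2 ?_
    rw [show (8100 : ℤ) / 3 = 2700 by norm_num]
    exact Carrier6137.not_isSoluble_padic_twoIsogenyQuartic_of_zmodPow 4 (by decide)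
  · refine Carrier6137.not_mem_twoIsogenySelmerGroup_of_not_isSoluble hB 2 ?_
    rw [show (8100 : ℤ) / -3 = -2700 by norm_num]
    exact Carrier6137.not_isSoluble_padic_twoIsogenyQuartic_of_zmodPow 5 (by decide)
  · refine Carrier6137.not_mem_twoIsogenySelmerGroup_of_not_isSoluble hB 2 ?_
    rw [show (8100 : ℤ) / 6 = 1350 by norm_num]
    exact Carrier6137.not_isSoluble_padic_twoIsogenyQuartic_of_zmodPow 4 (by decide)
  · refine Carrier6137.not_mem_twoIsogenySelmerGroup_of_not_isSoluble hB 2 ?_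
    rw [show (8100 : ℤ) / -6 = -1350 by norm_num]
    exact Carrier6137.not_isSoluble_padic_twoIsogenyQuartic_of_zmodPow 6 (by decide +kernel)
  · refine Carrier6137.not_mem_twoIsogenySelmerGroup_of_not_isSoluble hB 5 ?_
    rw [show (8100 : ℤ) / 5 = 1620 by norm_num]
    exact Carrier6137.not_isSoluble_padic_twoIsogenyQuartic_of_zmodPow 2 (by decide)
  · refine Carrier6137.not_mem_twoIsogenySelmerGroup_of_not_isSoluble hB 2 ?_
    rw [show (8100 : ℤ) / -5 = -1620 by norm_num]
    exact Carrier6137.not_isSoluble_padic_twoIsogenyQuartic_of_zmodPow 4 (by decide)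
  · refine Carrier6137.not_mem_twoIsogenySelmerGroup_of_not_isSoluble hB 2 ?_
    rw [show (8100 : ℤ) / 10 = 810 by norm_num]
    exact Carrier6137.not_isSoluble_padic_twoIsogenyQuartic_of_zmodPow 6 (by decide +kernel)
  · refine Carrier6137.not_mem_twoIsogenySelmerGroup_of_not_isSoluble hB 2 ?_
    rw [show (8100 : ℤ) / -10 = -810 by norm_num]
    exact Carrier6137.not_isSoluble_padic_twoIsogenyQuartic_of_zmodPow 4 (by decide)
  · refine Carrier6137.not_mem_twoIsogenySelmerGroup_of_not_isSoluble hB 2 ?_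
    rw [show (8100 : ℤ) / 15 = 540 by norm_num]
    exact Carrier6137.not_isSoluble_padic_twoIsogenyQuartic_of_zmodPow 4 (by decide)
  · refine Carrier6137.not_mem_twoIsogenySelmerGroup_of_not_isSoluble hB 5 ?_
    rw [show (8100 : ℤ) / -15 = -540 by norm_num]
    exact Carrier6137.not_isSoluble_padic_twoIsogenyQuartic_of_zmodPow 3 (by decide +kernel)
  · refine Carrier6137.not_mem_twoIsogenySelmerGroup_of_not_isSoluble hB 2 ?_
    rw [show (8100 : ℤ) / 30 = 270 by norm_num]
    exact Carrier6137.not_isSoluble_padic_twoIsogenyQuartic_of_zmodPow 4 (by decide)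
  · refine Carrier6137.not_mem_twoIsogenySelmerGroup_of_not_isSoluble hB 5 ?_
    rw [show (8100 : ℤ) / -30 = -270 by norm_num]
    exact Carrier6137.not_isSoluble_padic_twoIsogenyQuartic_of_zmodPow 2 (by decide)

/-- A squarefree integer dividing `8100` is `±` a divisor of `30`. [cite: SilvermanAEC2009, Prop. X.4.9] -/
private theorem mem_of_dvd_bY' {d : ℤ} (hsq : Squarefree d) (hd : d ∣ (8100 : ℤ)) :
    d ∈ ({1, -1, 2, -2, 3, -3, 5, -5, 6, -6, 10, -10, 15, -15, 30, -30} : Finset ℤ) := by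
  have hrad : d ∣ 30 := by
    have h5 : d ∣ (30 : ℤ) ^ 4 := dvd_trans hd ⟨100, by norm_num⟩
    exact (hsq.dvd_pow_iff_dvd (by norm_num)).mp h5
  have h1 : d.natAbs ∣ 30 := by
    have := Int.natAbs_dvd_natAbs.mpr hrad
    simpa using this
  have h2 : d.natAbs ∈ Nat.divisors 30 := Nat.mem_divisors.mpr ⟨h1, by norm_num⟩
  rw [show Nat.divisors 30 = {1, 2, 3, 5, 6, 10, 15, 30} by decide +kernel] at h2
  simp only [Finset.mem_insert, Finset.mem_singleton] at h2 ⊢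
  rcases Int.natAbs_eq d with h | h <;> rw [h] <;>
    rcases h2 with h2 | h2 | h2 | h2 | h2 | h2 | h2 | h2 <;> simp [h2]

/-- **`S(-20, 8100) ⊆ {1}`**. [cite: SilvermanAEC2009, Prop. X.4.9 and Example X.4.10] -/
theorem twoIsogenySelmerGroup'_Y_subset :
    twoIsogenySelmerGroup (-20) (8100) ⊆ ({1} : Finset ℤ) := by
  intro d hd
  obtain ⟨hsq, hdvd, -⟩ := (mem_twoIsogenySelmerGroup_iff (a := -20) (by norm_num : (8100 : ℤ) ≠ 0)).mp hd
  have hmem := mem_of_dvd_bY' hsq hdvd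
  obtain ⟨hm1, h2, hm2, h3, hm3, h6, hm6, h5, hm5, h10, hm10, h15, hm15, h30, hm30⟩ := not_mem_S'_Y
  simp only [Finset.mem_insert, Finset.mem_singleton] at hmem ⊢
  rcases hmem with rfl | rfl | rfl | rfl | rfl | rfl | rfl | rfl | rfl | rfl | rfl | rfl | rfl | rfl | rfl | rfl
  · simp
  · exact absurd hd hm1
  · exact absurd hd h2
  · exact absurd hd hm2
  · exact absurd hd h3
  · exact absurd hd hm3
  · exact absurd hd h5
  · exact absurd hd hm5
  · exact absurd hd h6
  · exact absurd hd hm6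
  · exact absurd hd h10
  · exact absurd hd hm10
  · exact absurd hd h15
  · exact absurd hd hm15
  · exact absurd hd h30
  · exact absurd hd hm30

/-- `2^k ≤ 2^n` forces `k ≤ n`. [cite: SilvermanAEC2009, Prop. X.4.9] -/
private theorem le_of_two_pow_le {k n : ℕ} (h : 2 ^ k ≤ 2 ^ n) : k ≤ n :=
  (Nat.pow_le_pow_iff_right (by norm_num)).mp h

/-- **`dim₂ S(10,-2000) ≤ 2` and `dim₂ S'(10,-2000) ≤ 0`.** [cite: SilvermanAEC2009, Prop. X.4.9] -/
theorem twoIsogenySelmerRank_Y_add_le :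
    twoIsogenySelmerRank (10) (-2000) ≤ 2 ∧ twoIsogenySelmerRank' (10) (-2000) ≤ 0 := by
  constructor
  · apply le_of_two_pow_le
    rw [two_pow_twoIsogenySelmerRank_eq_card habY]
    exact (Finset.card_le_card twoIsogenySelmerGroup_Y_subset).trans (by decide)
  · apply le_of_two_pow_le
    rw [two_pow_twoIsogenySelmerRank'_eq_card habY, twoIsogenySelmerGroup'_eq,
      show (-2 * (10) : ℤ) = -20 by norm_num, show ((10 : ℤ) ^ 2 - 4 * (-2000) : ℤ) = 8100 by norm_num]
    exact (Finset.card_le_card twoIsogenySelmerGroup'_Y_subset).trans (by decide)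

/-- **`rank E₀(ℚ) = 0`**: `rank + 2 ≤ dim₂ S + dim₂ S' ≤ 2 + 0`. [cite: SilvermanAEC2009, Prop. X.4.7 with Thm. X.4.2(a)] -/
theorem mordellWeilRank_Y : (⟨0, 10, 0, -2000, 0⟩ : WeierstrassCurve ℚ).mordellWeilRank = 0 := by
  haveI := isElliptic_Y
  have h := twoIsogeny_mordellWeilRank_add_two_le_holds (10) (-2000) habY
  rw [lit_Y] at h
  have h2 := twoIsogenySelmerRank_Y_add_le
  omega

/-- **The descent on `E₀` is sharp**: `dim₂ S + dim₂ S' ≤ rank + 2`. [cite: SilvermanAEC2009, Prop. X.4.7 with Thm. X.4.2(a)] -/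
theorem twoIsogenySelmerRank_Y_add_le_rank :
    twoIsogenySelmerRank (10) (-2000) + twoIsogenySelmerRank' (10) (-2000) ≤
      (⟨0, ((10 : ℤ) : ℚ), 0, ((-2000 : ℤ) : ℚ), 0⟩ : WeierstrassCurve ℚ).mordellWeilRank + 2 := by
  rw [lit_Y, mordellWeilRank_Y]
  have h := twoIsogenySelmerRank_Y_add_le
  omega

/-- **`Ш(E₀/ℚ)[2] = 0`** for `E₀ : y² = x(x + 50)(x − 40)`. [cite: SilvermanAEC2009, Prop. X.4.7 with Thm. X.4.2(a)] -/
theorem forall_mem_sha_Y_two_smul_eq_zero :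
    ∀ c ∈ (⟨0, 10, 0, -2000, 0⟩ : WeierstrassCurve ℚ).sha, 2 • c = 0 → c = 0 := by
  haveI : (⟨0, -((10 : ℤ) : ℚ) / 2, 0, (((10 : ℤ) : ℚ) ^ 2 - 4 * (-2000 : ℤ)) / 16, 0⟩ :
      WeierstrassCurve ℚ).IsElliptic := by rw [lit_V₀Y]; exact isElliptic_V₀Y
  haveI : (⟨0, ((10 : ℤ) : ℚ), 0, ((-2000 : ℤ) : ℚ), 0⟩ : WeierstrassCurve ℚ).IsElliptic := by
    rw [lit_Y]; exact isElliptic_Y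
  have h := forall_mem_sha_two_smul_eq_zero_of_selmerRank_add_le (a := 10) (b := -2000) habY
    twoIsogenySelmerRank_Y_add_le_rank
  rwa [lit_Y] at h

/-- **`t_2(E₀) = corank_{ℤ₂} Ш(E₀/ℚ)[2^∞] = 0`.** [cite: SilvermanAEC2009, Prop. X.4.7 with Thm. X.4.2(a)] -/
theorem shaCorank_Y_two : (⟨0, 10, 0, -2000, 0⟩ : WeierstrassCurve ℚ).shaCorank 2 = 0 := by
  haveI := isElliptic_Y
  haveI : Fact (Nat.Prime 2) := ⟨Nat.prime_two⟩
  exact shaCorank_eq_zero_of_forall _ 2 forall_mem_sha_Y_two_smul_eq_zero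

end Curve2000

end Literature.NumberTheory.EllipticCurves

end
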